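import Literature.NumberTheory.GaloisCohomology.Howard2004.CasselsTateSkewPairing
import HarnessLib

/-!
# Howard 2004, Prop. 1.4.1 + the displays (i)(ii) of the proof of Thm. 1.4.2 AS INTENDED BY THE PRINTED
# PROOF («C45.1″»): the statement of `prop141_casselsTate_skewPairing_atLevel` (C45.1′) under the two standing
# clauses of the cell's print-as-intended currency — `p ≠ 0` in `R` and `p ∤ #𝓞_K^×` (the F-161′ guards) — a
# WEAKENING of the cite-only fact, plus the kernel one-liner C45.1′ → C45.1″

Topic `NumberTheory/GaloisCohomology/Howard2004` (literature seat `bsd-print-x9-lit` g46, cell `pub/bsd-print-x9`).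
ONE named fact (`def … : Prop`, D-0014; cite-only, nothing asserted; debt +1) and ONE kernel theorem
`prop141_casselsTate_skewPairing_atLevel_printIntended_of_prop141 : C45.1′ → C45.1″`.  No definition, no instance,
no notation, no `sorry`; imports `CasselsTateSkewPairing` (C45.1′, p703846) only.  This is the F-161 → F-161′ pattern of
`DVRKolyvaginBoundPrintIntended.lean` (p710086; cell referee REF-167 / REF-169 / REF-169a) applied to C45.1′.

OCCASION (cell bus 2026-08-29T13:35:41Z, `bsd-line-x10b-p1-w7` g12, FINDING «C45.1′ TYPING — the hu axis»; verified at the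
page by this seat): C45.1′ quantifies over EVERY `DVRSetting` `S` with `S.SatisfiesH` (H.0–H.5 for the base triple
`(T, 𝓕, 𝓛)`) and EVERY `n ⊆ S.levelPrimes k`.  For `n ≠ ∅` print obtains H.0–H.5 for `(T^{(k)}, 𝓕(n))` from Lemma 1.5.1
[arXiv:1202.6340 = arXiv Lemma 2.5.1, p0009 L127–L133: «See Lemma 3.7.4 of [Mazur–Rubin] for the case of H.3. The other
cases are trivial»]; the H.4 clause for `𝓕(n)` at `λ ∣ n` is the self-orthogonality of the TRANSVERSE condition, i.e.
Prop. 1.1.9 [arXiv Prop. 2.1.9, p0005 L153–L163] for an `L`-transverse condition with `L` «a MAXIMAL totally tamely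
ramified abelian `p`-extension of `K_v`» [p0005 L53–L60], and §1.2 [p0006 L84–L94] takes `L` := the maximal
`p`-subextension of `K[ℓ]_λ/K_λ`, asserting it IS maximal («since `λ` splits completely in the Hilbert class field …
canonically identified with the `p`-Sylow subgroup of `G_ℓ` by class field theory»).  That identification needs
`p ∤ u_K = #𝓞_K^×/2` (`[K[ℓ] : K[1]] = (ℓ+1)/u_K`, Cox Thm. 7.24) and fails exactly at `(p, d_K) = (3, −3)` — the print gap
«How04-2.6.1@(3,−3)-units» (REF-167), the reason F-161′ carries the guard `¬ p ∣ Nat.card (𝓞 K)ˣ`.  The tree's transverse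
condition is Howard's ring-class DEFINITION (`transverseFixer`, `SelmerTriples.lean`), so at `(3, −3)` its `L` is NOT
maximal, `H¹ = H¹_f ⊕ H¹_tr` and the self-orthogonality of `𝓕(n)` at `λ` are not available (the engine's own lemmas
`isCompl_unramifiedSubgroup_transverseCondition_of_not_dvd_card_units` / `…_of_discr_lt` carry `hu` / `d_K < −4`), and
print's proof covers neither Lemma 1.5.1 nor the application of Prop. 1.4.1 / displays (i)(ii) to `(T^{(k)}, 𝓕(n))`
there.  ⇒ C45.1′ AS TYPED is STRONGER than print-as-intended on the corner `{(p, d_K) = (3, −3), n ≠ ∅}` (truth there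
unknown); C45.1″ below inserts the guards and is = print-as-intended.  Cell referee READING RULING no. 5 (REF-177,
2026-08-29T13:40:23Z, on the finding): «C45.1′ = Prop 1.4.1 / Lemma 1.5.1 AS WORDED, as applied — admissible cite-only leaf
with annotation «How04-2.4.1/2.5.1@(3,−3)-units»; for the as-intended currency mint C45.1″ := C45.1′ body +
`((p : ℕ) : R) ≠ 0 → ¬ p ∣ Nat.card (𝓞 K)ˣ →` after `S.SatisfiesH →` (the F-161′ 15-token insertion; `hp0` included for
guard symmetry / equal-characteristic safety) + one-liner C45.1′ → C45.1″».  This file follows the ruling token for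
token: BOTH F-161′ guards are inserted, in F-161′'s order — `((p : ℕ) : R) ≠ 0` (print gap «@eqchar», REF-169: the
coefficient-ring convention [p0004 L47–L51] admits equal characteristic while `𝓛_k` is keyed by `p^k` [p0006 L69–L70]
against the levels `R/𝔪^k`) and `¬ p ∣ Nat.card (𝓞 K)ˣ` (print gap «@(3,−3)-units», REF-167).  Weaker is never
stronger than print: both guards hold in every printed case of interest [p0004 L49–L51] and at every consumer.

CONSUMERS (cell bookkeeping, not part of the statement): every application site already binds `hu` — X10b frames via
`X10.thm413Hypotheses_of_classX10` (`d_K` odd, `≠ −3` ⇒ `#𝓞_K^× = 2`), X9 frames `p ≥ 5`, and the G87 engine's closing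
theorem `DVRSetting.thm161_printIntended_of_prop141` (p720105) concludes F-161′, whose own antecedents carry `hu` — so
re-deriving the α-plug `hasLevelDecompositionsAt_of_prop141` / p720105 from C45.1″ instead of C45.1′ is a by-name
re-point (prover's job, not this file's); the pen's r8 may key `closes` on C45.1″.  The entry theorems of
`bsd-line-x10b-p1-w7` g11/g12 (`…_iff_forall_full_hasLevelDecompositionsAt`, `…_of_forall_full_towerSkewPairings`)
conclude C45.1′, hence C45.1″ by the one-liner below.  HONEST FRAMING: typed ≠ proved ≠ endorsed; neither C45.1′ nor
C45.1″ is proved anywhere in the tree (a held modern proof text for the kernels and the skew identity is Morgan–Smith,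
arXiv:2103.08530, Thm. 1.3 / Thm. 3.7 — cell DOSSIER §76 — a PROOF text for a future kernel port, not a citation
upgrade); `thm161_dvrKolyvaginBound` / F-161′ are not proved by this file; no summit statement is proved; BSD is not
proved by any of this.

References: [Howard2004HeegnerKolyvagin] Prop. 1.4.1, Thm. 1.4.2 (arXiv:1202.6340 p0008 L83–L142, p0009 L1–L55),
Lemma 1.5.1 (p0009 L127–L133), Prop. 1.1.9 (p0005 L153–L163), §1.1 transverse condition (p0005 L53–L60), §1.2
(p0006 L84–L94), §1.6 ¶3 (p0011 L33–L44); [Flach1990]; [Cox2013] Thm. 7.24.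
-/

noncomputable section

open Function NumberField IsDedekindDomain Field IsLocalRing
open scoped NumberField ContRepresentation Classical

namespace Literature.NumberTheory.GaloisCohomology.Howard2004

open Literature.NumberTheory.GaloisRepresentations Literature.NumberTheory.GaloisRepresentations.DiscreteGaloisModule

/-- **Howard 2004, Prop. 1.4.1 and the displays (i)(ii) of the proof of Thm. 1.4.2, as invoked in §1.6 for
`(T^{(k)}, 𝓕(n))`, `n ∈ 𝓝^{(k)}`, AS INTENDED BY THE PRINTED PROOF (C45.1″)** — the statement of
`prop141_casselsTate_skewPairing_atLevel` (C45.1′: for every `DVRSetting` `S` with `S.SatisfiesH`, every level `k`, every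
`n` with `↑n ⊆ S.levelPrimes k`, every `t` with `t + 1 < e_k`, there is an `R/𝔪`-valued pairing on
`ℋ(n)[π^{t+1}] × ℋ(n)[π]`, `ℋ(n) = H¹_{𝓕(n)}(K, T^{(k)})`, `R`-equivariant in both slots, with LEFT kernel exactly
`π·ℋ(n)[π^{t+2}]`, RIGHT kernel exactly `π^{t+1}·ℋ(n)[π^{t+2}]` [Prop. 1.4.1 through the identifications of the proof of
Thm. 1.4.2, display (i), arXiv:1202.6340 p0008 L83–L130] and SKEW «`(a, π^{s-1}b)_{s,1} = -(b, π^{s-1}a)_{s,1}`» [display (ii),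
p0008 L142]) UNDER THE TWO STANDING CLAUSES OF THE PRINTED PROOF (the F-161′ guards): `p ≠ 0` in the DVR `R` (§1 coefficient
rings [p0004 L47–L51] vs `𝓛_k` keyed by `p^k` [p0006 L69–L70]; print gap «@eqchar», cell referee REF-169) and
`p ∤ #𝓞_K^×` — §1.2's identification of the maximal `p`-subextension of `K[ℓ]_λ/K_λ` with a MAXIMAL totally tamely
ramified abelian `p`-extension [p0006 L84–L94], through which Lemma 1.5.1 [p0009 L127–L133] supplies H.4 (transverse
self-orthogonality, Prop. 1.1.9 [p0005 L153–L163]) for `𝓕(n)`; it fails only at `(p, d_K) = (3, −3)` (print gap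
«How04-2.4.1/2.5.1@(3,−3)-units», REF-167 / REF-177).  RECORDED AS (REF-177 READING RULING no. 5, verbatim recipe):
C45.1′'s body with `((p : ℕ) : R) ≠ 0 → ¬ p ∣ Nat.card (𝓞 K)ˣ →` inserted after `S.SatisfiesH →` (the guards spelled as
in `thm161_dvrKolyvaginBound_printIntended` and the G87 engine files).  WEAKER than C45.1′
(`prop141_casselsTate_skewPairing_atLevel_printIntended_of_prop141`), = print-as-INTENDED; C45.1′ stays the record of
print-as-WORDED-and-applied.  PUBLISHED (Compositio 140 (2004); the printed proof covers exactly this scope); the kernel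
computation («a straightforward modification of the methods of [Flach]») and the verification of (ii) stay PRINT:
cite-only `def … : Prop`, no `_holds`.  A `Prop`; nothing asserted.
[cite: Howard2004HeegnerKolyvagin, Prop. 1.4.1 and Thm. 1.4.2 (proof, displays (i)(ii)) (arXiv:1202.6340 p0008 L83–L142, p0009 L1–L55), invoked for (T^{(k)}, 𝓕(n)), n ∈ 𝓝^{(k)}, in §1.6 ¶3 (p0011 L33–L44) via Lemma 1.5.1 (p0009 L127–L133), with §1.2 (p0006 L84–L94) and Prop. 1.1.9 (p0005 L153–L163)]
[cite: Flach1990, the generalised Cassels–Tate pairing and its kernels (J. reine angew. Math. 412, 113–127)] -/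
def prop141_casselsTate_skewPairing_atLevel_printIntended : Prop :=
  ∀ (p : ℕ) [Fact p.Prime] (K : Type) [Field K] [NumberField K]
    (R : Type) [CommRing R] [IsDomain R] [IsDiscreteValuationRing R] [Algebra ℤ_[p] R]
    (N : ℕ → Type) [∀ k, AddCommGroup (N k)] [∀ k, TopologicalSpace (N k)]
    [∀ k, DiscreteTopology (N k)] [∀ k, Module R (N k)]
    (Rk : ℕ → Type) [∀ k, CommRing (Rk k)] [∀ k, IsLocalRing (Rk k)] [∀ k, TopologicalSpace (Rk k)]
    [∀ k, DiscreteTopology (Rk k)] [∀ k, Algebra ℤ_[p] (Rk k)] [∀ k, Algebra R (Rk k)]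
    [∀ k, Module (Rk k) (N k)] [∀ k, IsScalarTower R (Rk k) (N k)]
    (Nbar : Type) [AddCommGroup Nbar] [TopologicalSpace Nbar] [DiscreteTopology Nbar]
    [∀ k, Module (Rk k) Nbar]
    (Nq : ℕ → Finset (HeightOneSpectrum (𝓞 K)) → Type) [∀ k n, AddCommGroup (Nq k n)]
    [∀ k n, TopologicalSpace (Nq k n)] [∀ k n, DiscreteTopology (Nq k n)]
    [∀ k n, Module (Rk k) (Nq k n)] [∀ k n, Module R (Nq k n)]
    [∀ k n, IsScalarTower R (Rk k) (Nq k n)]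
    (S : DVRSetting p K R N Rk Nbar Nq), S.SatisfiesH →
    ((p : ℕ) : R) ≠ 0 → ¬ p ∣ Nat.card (𝓞 K)ˣ →
    ∀ (k : ℕ) (n : Finset (HeightOneSpectrum (𝓞 K))), ↑n ⊆ S.levelPrimes k →
    ∀ (t : ℕ), t + 1 < S.e k →
    ∃ P : ↥((((S.t k).atLevel S.jbar n).cond).selmerGroup ⊓
        (galoisCohomology.scalarMapH1 (S.T.ρ k) (S.T.hlin k) (S.π ^ (t + 1))).ker) →+
      ↥((((S.t k).atLevel S.jbar n).cond).selmerGroup ⊓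
        (galoisCohomology.scalarMapH1 (S.T.ρ k) (S.T.hlin k) S.π).ker) →+ (R ⧸ IsLocalRing.maximalIdeal R),
      -- `R`-equivariance in the first slot («pairing of `R/𝔪`-vector spaces»)
      (∀ (r : R) (x x' : ↥((((S.t k).atLevel S.jbar n).cond).selmerGroup ⊓
          (galoisCohomology.scalarMapH1 (S.T.ρ k) (S.T.hlin k) (S.π ^ (t + 1))).ker))
          (w : ↥((((S.t k).atLevel S.jbar n).cond).selmerGroup ⊓
            (galoisCohomology.scalarMapH1 (S.T.ρ k) (S.T.hlin k) S.π).ker)),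
        (x' : galoisCohomology (S.T.ρ k) 1) =
          galoisCohomology.scalarMapH1 (S.T.ρ k) (S.T.hlin k) r (x : galoisCohomology (S.T.ρ k) 1) →
        P x' w = r • P x w) ∧
      -- `R`-equivariance in the second slot
      (∀ (r : R) (x : ↥((((S.t k).atLevel S.jbar n).cond).selmerGroup ⊓
          (galoisCohomology.scalarMapH1 (S.T.ρ k) (S.T.hlin k) (S.π ^ (t + 1))).ker))
          (w w' : ↥((((S.t k).atLevel S.jbar n).cond).selmerGroup ⊓
            (galoisCohomology.scalarMapH1 (S.T.ρ k) (S.T.hlin k) S.π).ker)),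
        (w' : galoisCohomology (S.T.ρ k) 1) =
          galoisCohomology.scalarMapH1 (S.T.ρ k) (S.T.hlin k) r (w : galoisCohomology (S.T.ρ k) 1) →
        P x w' = r • P x w) ∧
      -- nondegenerate on `V_s = ℋ[𝔪^s]/𝔪ℋ[𝔪^{s+1}]`: the LEFT kernel is exactly `π·ℋ[π^{t+2}]`
      (∀ x : ↥((((S.t k).atLevel S.jbar n).cond).selmerGroup ⊓
          (galoisCohomology.scalarMapH1 (S.T.ρ k) (S.T.hlin k) (S.π ^ (t + 1))).ker),
        (∀ w, P x w = 0) ↔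
          ∃ z ∈ (((S.t k).atLevel S.jbar n).cond).selmerGroup,
            galoisCohomology.scalarMapH1 (S.T.ρ k) (S.T.hlin k) (S.π ^ (t + 2)) z = 0 ∧
            (x : galoisCohomology (S.T.ρ k) 1) = galoisCohomology.scalarMapH1 (S.T.ρ k) (S.T.hlin k) S.π z) ∧
      -- nondegenerate on `W_s = ℋ[𝔪]/𝔪^sℋ[𝔪^{s+1}]`: the RIGHT kernel is exactly `π^{t+1}·ℋ[π^{t+2}]`
      (∀ w : ↥((((S.t k).atLevel S.jbar n).cond).selmerGroup ⊓
          (galoisCohomology.scalarMapH1 (S.T.ρ k) (S.T.hlin k) S.π).ker),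
        (∀ x, P x w = 0) ↔
          ∃ z ∈ (((S.t k).atLevel S.jbar n).cond).selmerGroup,
            galoisCohomology.scalarMapH1 (S.T.ρ k) (S.T.hlin k) (S.π ^ (t + 2)) z = 0 ∧
            (w : galoisCohomology (S.T.ρ k) 1) =
              galoisCohomology.scalarMapH1 (S.T.ρ k) (S.T.hlin k) (S.π ^ (t + 1)) z) ∧
      -- skew-symmetry «(a, π^{s-1}b)_{s,1} = -(b, π^{s-1}a)_{s,1}»
      (∀ (a b : ↥((((S.t k).atLevel S.jbar n).cond).selmerGroup ⊓
          (galoisCohomology.scalarMapH1 (S.T.ρ k) (S.T.hlin k) (S.π ^ (t + 1))).ker))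
          (a' b' : ↥((((S.t k).atLevel S.jbar n).cond).selmerGroup ⊓
            (galoisCohomology.scalarMapH1 (S.T.ρ k) (S.T.hlin k) S.π).ker)),
        (a' : galoisCohomology (S.T.ρ k) 1) =
          galoisCohomology.scalarMapH1 (S.T.ρ k) (S.T.hlin k) (S.π ^ t) (a : galoisCohomology (S.T.ρ k) 1) →
        (b' : galoisCohomology (S.T.ρ k) 1) =
          galoisCohomology.scalarMapH1 (S.T.ρ k) (S.T.hlin k) (S.π ^ t) (b : galoisCohomology (S.T.ρ k) 1) →
        P a b' = - P b a')

/-- **C45.1′ ⇒ C45.1″**: the print-as-intended statement is a WEAKENING of the cite-only fact as typed (drop the two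
guards `p ≠ 0` in `R` and `p ∤ #𝓞_K^×`).  [cite: Howard2004HeegnerKolyvagin, Prop. 1.4.1, Thm. 1.4.2] -/
theorem prop141_casselsTate_skewPairing_atLevel_printIntended_of_prop141
    (h : prop141_casselsTate_skewPairing_atLevel) :
    prop141_casselsTate_skewPairing_atLevel_printIntended :=
  fun p _ K _ _ R _ _ _ _ N _ _ _ _ Rk _ _ _ _ _ _ _ _ Nbar _ _ _ _ Nq _ _ _ _ _ _ S hy _ _ k n hn t ht ↦
    h p K R N Rk Nbar Nq S hy k n hn t ht

end Literature.NumberTheory.GaloisCohomology.Howard2004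

end
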